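import Mathlib

/-!
# SoloBlind E57 — Eisenstein depth splits sub-additively over complementary Hecke factors

Solo programme `solo-Langlands-blind`, own line (O1b), s118 (tower theory §13.14).  Let `θ : T → ℤ/p^n` be the Eisenstein
character of the full Hecke algebra (`n = v_p|T/I|`), and let `T` act faithfully on `S = S^{new} ⊕ S^{old}`, so that
`ker π_new · ker π_old = 0`.  If `t` kills the new part and `s` kills the old part then `t s = 0`, hence `θ(t) θ(s) = 0` in `ℤ/p^n`,
hence `v_p θ(t) + v_p θ(s) ≥ n`.  Taking `t`, `s` of minimal valuation gives `μ + c_old ≥ n`: the depth `μ` of the Eisenstein system on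
the NEW quotient is at least `n − c_old`, where `c_old` is its depth on the old forms.  Abstract content: `val_add_val_ge_of_mul_eq_zero`.
-/

set_option linter.dupNamespace false

namespace Summit.Langlands.Langlands.Theorems.SoloBlindDepthSplitting

/-- In `ZMod (p ^ n)`: if `x * y = 0` with `x, y ≠ 0` then `n ≤ v_p(x) + v_p(y)` (valuations of the canonical representatives). -/
theorem val_add_val_ge_of_mul_eq_zero (p n : ℕ) [hp : Fact p.Prime] (x y : ZMod (p ^ n)) (hxy : x * y = 0)
    (hx : x ≠ 0) (hy : y ≠ 0) : n ≤ padicValNat p x.val + padicValNat p y.val := by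
  haveI : NeZero (p ^ n) := ⟨pow_ne_zero n hp.out.ne_zero⟩
  have hx' : x.val ≠ 0 := by rwa [ne_eq, ZMod.val_eq_zero]
  have hy' : y.val ≠ 0 := by rwa [ne_eq, ZMod.val_eq_zero]
  have h : p ^ n ∣ x.val * y.val := by
    rw [← ZMod.natCast_eq_zero_iff]
    push_cast
    rw [ZMod.natCast_zmod_val, ZMod.natCast_zmod_val]
    exact hxy
  rw [← padicValNat.mul hx' hy']
  exact (padicValNat_dvd_iff_le (mul_ne_zero hx' hy')).mp h

variable {T : Type*} [CommRing T]

/-- Ring form: for a character `θ : T →+* ZMod (p^n)` and elements `t s` with `t * s = 0` (e.g. `t ∈ ker π_new`, `s ∈ ker π_old`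
of a faithful action on `S^{new} ⊕ S^{old}`), the valuations of `θ t` and `θ s` add up to at least `n`. -/
theorem depth_new_add_depth_old_ge (p n : ℕ) [Fact p.Prime] (θ : T →+* ZMod (p ^ n)) (t s : T) (hts : t * s = 0)
    (ht : θ t ≠ 0) (hs : θ s ≠ 0) : n ≤ padicValNat p (θ t).val + padicValNat p (θ s).val :=
  val_add_val_ge_of_mul_eq_zero p n (θ t) (θ s) (by rw [← map_mul, hts, map_zero]) ht hs

/-- Ideal form: if `KA * KB = ⊥` then any `t ∈ KA`, `s ∈ KB` satisfy the valuation inequality under `θ`. -/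
theorem depth_ge_of_ideal_mul_eq_bot (p n : ℕ) [Fact p.Prime] (θ : T →+* ZMod (p ^ n)) (KA KB : Ideal T)
    (h : KA * KB = ⊥) (t s : T) (ht : t ∈ KA) (hs : s ∈ KB) (ht0 : θ t ≠ 0) (hs0 : θ s ≠ 0) :
    n ≤ padicValNat p (θ t).val + padicValNat p (θ s).val := by
  have hts : t * s = 0 := by
    have : t * s ∈ KA * KB := Ideal.mul_mem_mul ht hs
    rw [h] at this
    exact (Submodule.mem_bot T).mp this
  exact depth_new_add_depth_old_ge p n θ t s hts ht0 hs0

end Summit.Langlands.Langlands.Theorems.SoloBlindDepthSplitting
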